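import Summits.CriticalPhenomena.PercolationContinuityZ3.Theorems.PercNearOneGluingNoHeavyLowerTailSahiThreeCopyTwoPointCertsK5Core
import Summits.CriticalPhenomena.PercolationContinuityZ3.Theorems.PercNearOneGluingNoHeavyLowerTailSahiThreeCopyTwoPointCertsK5Data1
import Summits.CriticalPhenomena.PercolationContinuityZ3.Theorems.PercNearOneGluingNoHeavyLowerTailSahiThreeCopyTwoPointCertsK5Data2
import Summits.CriticalPhenomena.PercolationContinuityZ3.Theorems.PercNearOneGluingNoHeavyLowerTailSahiThreeCopyTwoPointCertsK5Data3
import Summits.CriticalPhenomena.PercolationContinuityZ3.Theorems.PercNearOneGluingNoHeavyLowerTailSahiThreeCopyTwoPointCertsK5Data4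
import Summits.CriticalPhenomena.PercolationContinuityZ3.Theorems.PercNearOneGluingNoHeavyLowerTailSahiThreeCopyTwoPointCertsK5Data5
import Summits.CriticalPhenomena.PercolationContinuityZ3.Theorems.PercNearOneGluingNoHeavyLowerTailSahiThreeCopyTwoPointCertsK5Data6
import Summits.CriticalPhenomena.PercolationContinuityZ3.Theorems.PercNearOneGluingNoHeavyLowerTailSahiThreeCopyTwoPointCertsK5Data7
import Summits.CriticalPhenomena.PercolationContinuityZ3.Theorems.PercNearOneGluingNoHeavyLowerTailSahiThreeCopyTwoPointCertsK5Data8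
import Summits.CriticalPhenomena.PercolationContinuityZ3.Theorems.PercNearOneGluingNoHeavyLowerTailSahiThreeCopyTwoPointCertsK5Data9
import Summits.CriticalPhenomena.PercolationContinuityZ3.Theorems.PercNearOneGluingNoHeavyLowerTailSahiThreeCopyTwoPointCertsK5Data10
import Summits.CriticalPhenomena.PercolationContinuityZ3.Theorems.PercNearOneGluingNoHeavyLowerTailSahiThreeCopyTwoPointCertsK5Data11
import Summits.CriticalPhenomena.PercolationContinuityZ3.Theorems.PercNearOneGluingNoHeavyLowerTailSahiThreeCopyTwoPointCertsK5Data12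
import Summits.CriticalPhenomena.PercolationContinuityZ3.Theorems.PercNearOneGluingNoHeavyLowerTailSahiThreeCopyTwoPointCertsK5Data13
import Summits.CriticalPhenomena.PercolationContinuityZ3.Theorems.PercNearOneGluingNoHeavyLowerTailSahiThreeCopyTwoPointCertsK5Data14
import Summits.CriticalPhenomena.PercolationContinuityZ3.Theorems.PercNearOneGluingNoHeavyLowerTailSahiThreeCopyTwoPointCertsK5Data15
import Summits.CriticalPhenomena.PercolationContinuityZ3.Theorems.PercNearOneGluingNoHeavyLowerTailSahiThreeCopyTwoPointCertsK5Data16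
import Summits.CriticalPhenomena.PercolationContinuityZ3.Theorems.PercNearOneGluingNoHeavyLowerTailSahiThreeCopyTwoPointCertsK5Data17
import Summits.CriticalPhenomena.PercolationContinuityZ3.Theorems.PercNearOneGluingNoHeavyLowerTailSahiThreeCopyTwoPointCertsK5Data18
import Summits.CriticalPhenomena.PercolationContinuityZ3.Theorems.PercNearOneGluingNoHeavyLowerTailSahiThreeCopyTwoPointCertsK5Data19
import Summits.CriticalPhenomena.PercolationContinuityZ3.Theorems.PercNearOneGluingNoHeavyLowerTailSahiThreeCopyTwoPointCertsK5Data20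
import Summits.CriticalPhenomena.PercolationContinuityZ3.Theorems.PercNearOneGluingNoHeavyLowerTailSahiThreeCopyTwoPointCertsK5Data21
import Summits.CriticalPhenomena.PercolationContinuityZ3.Theorems.PercNearOneGluingNoHeavyLowerTailSahiThreeCopyTwoPointCertsK5Data22
import Summits.CriticalPhenomena.PercolationContinuityZ3.Theorems.PercNearOneGluingNoHeavyLowerTailSahiThreeCopyTwoPointCertsK5Data23
import Summits.CriticalPhenomena.PercolationContinuityZ3.Theorems.PercNearOneGluingNoHeavyLowerTailSahiThreeCopyTwoPointCertsK5Data24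
import Summits.CriticalPhenomena.PercolationContinuityZ3.Theorems.PercNearOneGluingNoHeavyLowerTailSahiThreeCopyTwoPointCertsK5Data25
import Summits.CriticalPhenomena.PercolationContinuityZ3.Theorems.PercNearOneGluingNoHeavyLowerTailSahiThreeCopyTwoPointCertsK5Data26
import Summits.CriticalPhenomena.PercolationContinuityZ3.Theorems.PercNearOneGluingNoHeavyLowerTailSahiThreeCopyTwoPointCertsK5Data27
import Summits.CriticalPhenomena.PercolationContinuityZ3.Theorems.PercNearOneGluingNoHeavyLowerTailSahiThreeCopyTwoPointCertsK5Data28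
import Summits.CriticalPhenomena.PercolationContinuityZ3.Theorems.PercNearOneGluingNoHeavyLowerTailSahiThreeCopyTwoPointCertsK5Data29
import Summits.CriticalPhenomena.PercolationContinuityZ3.Theorems.PercNearOneGluingNoHeavyLowerTailSahiThreeCopyTwoPointCertsK5Data30
import Summits.CriticalPhenomena.PercolationContinuityZ3.Theorems.PercNearOneGluingNoHeavyLowerTailSahiThreeCopyTwoPointCertsK5Data31
import Summits.CriticalPhenomena.PercolationContinuityZ3.Theorems.PercNearOneGluingNoHeavyLowerTailSahiThreeCopyTwoPointCertsK5Data32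
import Summits.CriticalPhenomena.PercolationContinuityZ3.Theorems.PercNearOneGluingNoHeavyLowerTailSahiThreeCopyTwoPointCertsK5Data33
import Summits.CriticalPhenomena.PercolationContinuityZ3.Theorems.PercNearOneGluingNoHeavyLowerTailSahiThreeCopyTwoPointCertsK5Data34
import Summits.CriticalPhenomena.PercolationContinuityZ3.Theorems.PercNearOneGluingNoHeavyLowerTailSahiThreeCopyTwoPointCertsK5Data35
import Summits.CriticalPhenomena.PercolationContinuityZ3.Theorems.PercNearOneGluingNoHeavyLowerTailSahiThreeCopyTwoPointCertsK5Data36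
import Summits.CriticalPhenomena.PercolationContinuityZ3.Theorems.PercNearOneGluingNoHeavyLowerTailSahiThreeCopyTwoPointCertsK5Data37
import Summits.CriticalPhenomena.PercolationContinuityZ3.Theorems.PercNearOneGluingNoHeavyLowerTailSahiThreeCopyTwoPointCertsK5Data38
import Summits.CriticalPhenomena.PercolationContinuityZ3.Theorems.PercNearOneGluingNoHeavyLowerTailSahiThreeCopyTwoPointCertsK5Data39
import Summits.CriticalPhenomena.PercolationContinuityZ3.Theorems.PercNearOneGluingNoHeavyLowerTailSahiThreeCopyTwoPointCertsK5Data40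
import Summits.CriticalPhenomena.PercolationContinuityZ3.Theorems.PercNearOneGluingNoHeavyLowerTailSahiThreeCopyTwoPointCertsK5Data41
import Summits.CriticalPhenomena.PercolationContinuityZ3.Theorems.PercNearOneGluingNoHeavyLowerTailSahiThreeCopyTwoPointCertsK5Data42
import Summits.CriticalPhenomena.PercolationContinuityZ3.Theorems.PercNearOneGluingNoHeavyLowerTailSahiThreeCopyTwoPointCertsK5Data43
import Summits.CriticalPhenomena.PercolationContinuityZ3.Theorems.PercNearOneGluingNoHeavyLowerTailSahiThreeCopyTwoPointCertsK5Data44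
import Summits.CriticalPhenomena.PercolationContinuityZ3.Theorems.PercNearOneGluingNoHeavyLowerTailSahiThreeCopyTwoPointCertsK5Data45
import Summits.CriticalPhenomena.PercolationContinuityZ3.Theorems.PercNearOneGluingNoHeavyLowerTailSahiThreeCopyTwoPointCertsK5Data46
import Summits.CriticalPhenomena.PercolationContinuityZ3.Theorems.PercNearOneGluingNoHeavyLowerTailSahiThreeCopyTwoPointCertsK5Data47
import Summits.CriticalPhenomena.PercolationContinuityZ3.Theorems.PercNearOneGluingNoHeavyLowerTailSahiThreeCopyTwoPointCertsK5Data48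
import Summits.CriticalPhenomena.PercolationContinuityZ3.Theorems.PercNearOneGluingNoHeavyLowerTailSahiThreeCopyTwoPointCertsK5Data49

/-!
# Sahi's three-function conjecture — `k = 5` certificate machinery III: the orbit cover and the table

Companion of `…TwoPointCertsK5Core` and the DATA files `…TwoPointCertsK5Data1–49` (seat `prim-sahi-p1`, generation 61; `--supports
stmt-CriticalPhenomena-4575`).  COMPUTATIONAL: `certTable5_size`, `coverAll5_true` (`native_decide`).
* The orbit table / validated lookup / cover check (`perms5`, `entry5`, `key5`, `orbitTab5`, `bsearch5`, `validate5`, `findRep5`,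
  `findRep5_spec`, `coverWith5`, `rep_of_coverWith5` — as at `k = 4`), chunks `checkChunk5`/`checkEntry5_of_chunk`, and
  ★ `frontGood_five_interior_of_table`: a covering table whose entries all have the sandwich facts gives `FrontGood 5 π 1_A` for every
  `π ∈ {1,2}^5` and every up-set `A` (relabelling transfer `tc_frontFn_nonneg_of_relab` + completeness `mem_upList5`).
* `certTable5` (3710 entries = the 49 DATA parts), `certTable5_size`, ★ `coverAll5_true`.
The per-entry checks are in `…TwoPointCertsK5Check1–8` / `…Brute1a–10b`, the theorem in `…TwoPointCertsK5`. [this work]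
-/

namespace Summit.CriticalPhenomena.PercolationContinuityZ3.Theorems.SahiThreeCopy

open Finset Function Literature.Combinatorics.Sahi2008
open scoped BigOperators

/-! ### The orbit table and the cover check (k = 5), parametrised by the certificate table -/

section Cover5

variable (T : Array Entry5)

/-- `S₅` as a list of permutations (data). [this work] -/
def perms5 : List (Equiv.Perm (Fin 5)) := permsOfList (List.finRange 5)

/-- Entry `j` (default past the end). [this work] -/
def entry5 (j : ℕ) : Entry5 := T.getD j (0, 0, 0, 0, 0, 0, 0, [], [])

/-- Search key of a pair `(π, F)` (base-4 profile code; interior profiles have digits `1, 2`). [this work] -/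
def key5 (π : Fin 5 → ℕ) (F : Finset (Fin (2 ^ 5))) : ℕ := maskOf F * 1024 + profCode5 π

/-- The orbit table: for every entry `j` and `σ ∈ S₅`, the key of `σ·(entry j)` with `(j, σ)`, sorted by key. [this work] -/
def orbitTab5 : Array (ℕ × ℕ × Equiv.Perm (Fin 5)) :=
  ((List.range T.size).flatMap fun j =>
    perms5.map fun σ : Equiv.Perm (Fin 5) =>
      (key5 (profOfBits5 (entry5 T j).pb ∘ ⇑σ) ((setOfMask5 (entry5 T j).fm).image (permCode ⇑σ)), j, σ)).toArray.qsort
    fun a b => a.1 < b.1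

/-- Binary search in the orbit table (fuelled). [this work] -/
def bsearch5 (OT : Array (ℕ × ℕ × Equiv.Perm (Fin 5))) (key : ℕ) : ℕ → ℕ → ℕ → Option ℕ
  | 0, _, _ => none
  | fuel + 1, a, b =>
    if b ≤ a then none
    else if (OT.getD ((a + b) / 2) (0, 0, 1)).1 = key then some ((a + b) / 2)
    else if (OT.getD ((a + b) / 2) (0, 0, 1)).1 < key then bsearch5 OT key fuel ((a + b) / 2 + 1) b
    else bsearch5 OT key fuel a ((a + b) / 2)

/-- Validation of a candidate `(key, j, σ)` against `(π, F)`. [this work] -/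
def validate5 (t : ℕ × ℕ × Equiv.Perm (Fin 5)) (π : Fin 5 → ℕ) (F : Finset (Fin (2 ^ 5))) : Option (ℕ × Equiv.Perm (Fin 5)) :=
  if t.2.1 < T.size ∧ F = (setOfMask5 (entry5 T t.2.1).fm).image (permCode ⇑t.2.2) ∧ π = profOfBits5 (entry5 T t.2.1).pb ∘ ⇑t.2.2
  then some (t.2.1, t.2.2) else none

/-- Locate a representative of `(π, F)` (searched, then VALIDATED). [this work] -/
def findRep5 (OT : Array (ℕ × ℕ × Equiv.Perm (Fin 5))) (π : Fin 5 → ℕ) (F : Finset (Fin (2 ^ 5))) :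
    Option (ℕ × Equiv.Perm (Fin 5)) :=
  match bsearch5 OT (key5 π F) 64 0 OT.size with
  | none => none
  | some i => validate5 T (OT.getD i (0, 0, 1)) π F

/-- What a successful `findRep5` guarantees. [this work] -/
theorem findRep5_spec {OT : Array (ℕ × ℕ × Equiv.Perm (Fin 5))} {π : Fin 5 → ℕ} {F : Finset (Fin (2 ^ 5))} {j : ℕ}
    {σ : Equiv.Perm (Fin 5)} (h : findRep5 T OT π F = some (j, σ)) :
    j < T.size ∧ F = (setOfMask5 (entry5 T j).fm).image (permCode ⇑σ) ∧ π = profOfBits5 (entry5 T j).pb ∘ ⇑σ := by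
  unfold findRep5 at h
  split at h
  · exact absurd h (by simp)
  · unfold validate5 at h
    split_ifs at h with hc
    simp only [Option.some.injEq, Prod.mk.injEq] at h
    obtain ⟨rfl, rfl⟩ := h
    exact hc

/-- The cover check over `U` and the interior profiles `{1,2}^5`: every `(π, F)`, `F ∈ U` nonempty, has a validated representative. [this work] -/
def coverWith5 (U : Finset (Finset (Fin (2 ^ 5)))) (OT : Array (ℕ × ℕ × Equiv.Perm (Fin 5))) : Bool :=
  decide (∀ π : Fin 5 → Bool, allMem U (fun F => decide (F = ∅) || (findRep5 T OT (fun i => if π i then 2 else 1) F).isSome) = true)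

/-- Unpacking `coverWith5`. [this work] -/
theorem rep_of_coverWith5 {U : Finset (Finset (Fin (2 ^ 5)))} {OT : Array (ℕ × ℕ × Equiv.Perm (Fin 5))}
    (h : coverWith5 T U OT = true) (π : Fin 5 → Bool) {F : Finset (Fin (2 ^ 5))} (hF : F ∈ U) (hne : F ≠ ∅) :
    ∃ (j : ℕ) (σ : Equiv.Perm (Fin 5)), j < T.size ∧ F = (setOfMask5 (entry5 T j).fm).image (permCode ⇑σ) ∧
      (fun i => if π i then 2 else 1) = profOfBits5 (entry5 T j).pb ∘ ⇑σ := by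
  unfold coverWith5 at h
  rw [decide_eq_true_eq] at h
  have h1 := (allMem_eq_true.1 (h π)) F hF
  rw [Bool.or_eq_true, decide_eq_true_eq] at h1
  rcases h1 with h1 | h1
  · exact absurd h1 hne
  rw [Option.isSome_iff_exists] at h1
  obtain ⟨⟨j, σ⟩, hfind⟩ := h1
  exact ⟨j, σ, findRep5_spec T hfind⟩

/-- A chunk of the certificate check: entries `a ≤ j < a + n` (the local family list and the arrangement table are parameters,
evaluated once). [this work] -/
def checkChunk5 (U5 : Finset (Finset (Fin (2 ^ 5)))) (U4 : Finset (Finset (Fin (2 ^ 4))))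
    (AT : Array (Finset (Fin (2 ^ 5) × Fin (2 ^ 5) × Fin (2 ^ 5)))) (a n : ℕ) : Bool :=
  (List.range' a n).all fun j => checkEntry5 U5 U4 AT (entry5 T j)

/-- Unpacking a chunk. [this work] -/
theorem checkEntry5_of_chunk {U5 : Finset (Finset (Fin (2 ^ 5)))} {U4 : Finset (Finset (Fin (2 ^ 4)))}
    {AT : Array (Finset (Fin (2 ^ 5) × Fin (2 ^ 5) × Fin (2 ^ 5)))}
    {a n : ℕ} (h : checkChunk5 T U5 U4 AT a n = true) {j : ℕ} (h1 : a ≤ j) (h2 : j < a + n) :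
    checkEntry5 U5 U4 AT (entry5 T j) = true := by
  unfold checkChunk5 at h
  rw [List.all_eq_true] at h
  exact h j (List.mem_range'_1.2 ⟨h1, h2⟩)

/-- ★ **From a covering, fully checked table to the theorem at the interior profiles.**  If every entry of `T` passes and
`(U, orbitTab)` covers `upList5 × {1,2}^5`, then `FrontGood 5 π 1_A` for every `π ∈ {1,2}^5` and every up-set `A`. [this work] -/
theorem frontGood_five_interior_of_table {OT : Array (ℕ × ℕ × Equiv.Perm (Fin 5))} (hcov : coverWith5 T upList5 OT = true)
    (hall : ∀ j < T.size, EntryFacts5 (entry5 T j)) (π : Fin 5 → Bool) {A : Finset (Pt 5)}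
    (hA : IsUpperSet (A : Set (Pt 5))) : FrontGood 5 (fun i => if π i then 2 else 1) (setInd A) := by
  intro d b G H hG hH hGm hHm
  by_cases hA0 : A = ∅
  · rw [hA0]; exact tc_frontFn_setInd_empty_nonneg (k := 5) (fun i => if π i then 2 else 1) b hG hH hGm hHm
  have hne : A.map (codeE 5).toEmbedding ≠ ∅ := by rwa [Ne, Finset.map_eq_empty]
  have hU : A.map (codeE 5).toEmbedding ∈ upList5 := mem_upList5 (upClosedC_of_mem (map_mem_upSetsC hA))
  obtain ⟨j, σ, hj, hFeq, hπeq⟩ := rep_of_coverWith5 T hcov π hU hne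
  have hfacts := hall j hj
  unfold EntryFacts5 at hfacts
  set F₀ := setOfMask5 (entry5 T j).fm with hF₀
  set π₀ := profOfBits5 (entry5 T j).pb with hπ₀
  set A₀ : Finset (Pt 5) := F₀.map (codeE 5).symm.toEmbedding with hA₀def
  have hA₀ : A₀.map (codeE 5).toEmbedding = F₀ := by
    ext x
    rw [hA₀def, Finset.mem_map_equiv, Finset.mem_map_equiv, Equiv.symm_symm, Equiv.apply_symm_apply]
  rw [← hA₀] at hfacts
  obtain ⟨h0, h12⟩ := hfacts
  have hAA : A = A₀.map (relab σ).toEmbedding := by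
    rw [← Finset.map_inj (f := (codeE 5).toEmbedding), map_relab_codeE, hA₀]
    exact hFeq
  exact tc_frontFn_nonneg_of_relab σ π₀ A₀ _ h0 h12 hπeq hAA b hG hH hGm hHm

end Cover5

/-! ### The table -/

section Table

/-- ★ The `k = 5` certificate table (3710 entries, one per `S₅`-orbit of `(f, π)`, `π ∈ {1,2}^5`, `f` nonempty). [this work] -/
def certTable5 : Array Entry5 := 
  certTable5Part1 ++ certTable5Part2 ++ certTable5Part3 ++ certTable5Part4 ++ certTable5Part5 ++ certTable5Part6 ++ certTable5Part7 ++ certTable5Part8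
    ++ certTable5Part9 ++ certTable5Part10 ++ certTable5Part11 ++ certTable5Part12 ++ certTable5Part13 ++ certTable5Part14 ++ certTable5Part15 ++ certTable5Part16
    ++ certTable5Part17 ++ certTable5Part18 ++ certTable5Part19 ++ certTable5Part20 ++ certTable5Part21 ++ certTable5Part22 ++ certTable5Part23 ++ certTable5Part24
    ++ certTable5Part25 ++ certTable5Part26 ++ certTable5Part27 ++ certTable5Part28 ++ certTable5Part29 ++ certTable5Part30 ++ certTable5Part31 ++ certTable5Part32
    ++ certTable5Part33 ++ certTable5Part34 ++ certTable5Part35 ++ certTable5Part36 ++ certTable5Part37 ++ certTable5Part38 ++ certTable5Part39 ++ certTable5Part40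
    ++ certTable5Part41 ++ certTable5Part42 ++ certTable5Part43 ++ certTable5Part44 ++ certTable5Part45 ++ certTable5Part46 ++ certTable5Part47 ++ certTable5Part48
    ++ certTable5Part49

/-- The table has `3710` entries (by evaluation). [this work] -/
theorem certTable5_size : certTable5.size = 3710 := by
  native_decide

/-- ★ The cover check passes (by evaluation): every `(π, F)`, `π ∈ {1,2}^5`, `F` a nonempty up-set of `{0,1}^5` (all of
`upList5`), has a validated representative in `certTable5` up to `S₅`. [this work] -/
theorem coverAll5_true : coverWith5 certTable5 upList5 (orbitTab5 certTable5) = true := by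
  native_decide

end Table

end Summit.CriticalPhenomena.PercolationContinuityZ3.Theorems.SahiThreeCopy
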